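import Summits.ResolutionOfSingularities.ResolutionOfSingularities.Theorems.HomologicalConductorNoZenoUnramifiedPoints
import Mathlib.AlgebraicGeometry.Morphisms.FiniteType
import Mathlib.RingTheory.RingHom.Flat
import Mathlib.RingTheory.RingHom.Unramified
import Mathlib.RingTheory.RingHom.FiniteType
import HarnessLib

/-!
# Crux `NoZenoR` (stmt-ResolutionOfSingularities-19943), β layer, `stub_L1wCoreF` descent brick: BC-4b hypothesis (U) DISCHARGED
# — `X ×_S Spec Ŝ → X` is unramified at every point when `Ŝ` is a localisation of an unramified finite-type `S`-algebra

Route `ResolutionOfSingularities/HomologicalConductor`, crux chain W4.4.  OURS (cell res-hironaka, seat res-L0-w44-stub-2,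
(L1)-PREP v4 §2 / planner (ρ48)); AI-written, weaker than expert review; nothing here is a statement of the manuscript
under review (Hironaka 2017).  Def-free, fact-free, `--supports 19943 --as helper`.

For res-D-pv-039's Galois splitting germ `Ŝ = B_𝔫`, `B = S[α₁,…,αₙ]` finite étale over `S`, the projection
`σ : X ×_S Spec Ŝ → X` factors as `X ×_S Spec Ŝ ≅ (X ×_S Spec B) ×_{Spec B} Spec Ŝ → X ×_S Spec B → X`: a base change
of the localisation `Spec Ŝ → Spec B` (a flat preimmersion) followed by a base change of `Spec B → Spec S` (formally
unramified, locally of finite type).  By `…NoZenoUnramifiedPoints.map_maximalIdeal_stalkMap_eq_of_fac`,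
`𝔪_{σ ζ}·𝒪_{X_B,ζ} = 𝔪_ζ` at EVERY point `ζ` — in particular the hypothesis `hunr` of
`…NoZenoGaloisAscent.isMinimalResolution_of_flat_of_symmetric`.

* `specMap_algebraMap_eq_comp` — `Spec (S → Ŝ) = Spec (B → Ŝ) ≫ Spec (S → B)`;
* **`map_maximalIdeal_stalkMap_fst_eq`** — the statement above, for `[IsLocalization M Ŝ]`,
  `[Algebra.FormallyUnramified S B]`, `[Algebra.FiniteType S B]` (the `hunr` hypothesis for `X_B := pullback π (Spec (S → Ŝ))`
  is `fun ζ _ => map_maximalIdeal_stalkMap_fst_eq π M ζ`).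

References: The Stacks Project, Tags 00UW, 02FM [`StacksProject`]; A. Grothendieck, EGA IV₄ 17.4.1 (context) [folklore].
-/

noncomputable section

-- single-problem summit: the doubled namespace component `ResolutionOfSingularities` is forced
set_option linter.dupNamespace false

namespace Summit.ResolutionOfSingularities.ResolutionOfSingularities.Theorems.NoZeno.ExcCount

open CategoryTheory AlgebraicGeometry Limits IsLocalRing

universe u

variable {S B Ŝ : Type u} [CommRing S] [CommRing B] [CommRing Ŝ] [Algebra S B] [Algebra B Ŝ] [Algebra S Ŝ]
  [IsScalarTower S B Ŝ] {X : Scheme.{u}} (π : X ⟶ Spec (.of S))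

/-- `Spec (S → Ŝ) = Spec (B → Ŝ) ≫ Spec (S → B)` for a tower `S → B → Ŝ`. [folklore] -/
theorem specMap_algebraMap_eq_comp :
    Spec.map (CommRingCat.ofHom (algebraMap S Ŝ)) =
      Spec.map (CommRingCat.ofHom (algebraMap B Ŝ)) ≫ Spec.map (CommRingCat.ofHom (algebraMap S B)) := by
  rw [← Spec.map_comp, ← CommRingCat.ofHom_comp, ← IsScalarTower.algebraMap_eq]

/-- **`X ×_S Spec Ŝ → X` is unramified at every point** (`𝔪_{σ ζ}·𝒪_ζ = 𝔪_ζ`) when `Ŝ` is a localisation of a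
formally unramified, finite-type `S`-algebra `B`: `σ` is (an isomorphism followed by) a base change of the flat
preimmersion `Spec Ŝ → Spec B` followed by a base change of the formally unramified, locally-of-finite-type
`Spec B → Spec S`. [cite: StacksProject, Tag 00UW] -/
theorem map_maximalIdeal_stalkMap_fst_eq (M : Submonoid B) [IsLocalization M Ŝ] [Algebra.FormallyUnramified S B]
    [Algebra.FiniteType S B] (ζ : ↑(pullback π (Spec.map (CommRingCat.ofHom (algebraMap S Ŝ))))) :
    (maximalIdeal (X.presheaf.stalk ((pullback.fst π (Spec.map (CommRingCat.ofHom (algebraMap S Ŝ)))).base ζ))).map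
        ((pullback.fst π (Spec.map (CommRingCat.ofHom (algebraMap S Ŝ)))).stalkMap ζ).hom =
      maximalIdeal ((pullback π (Spec.map (CommRingCat.ofHom (algebraMap S Ŝ)))).presheaf.stalk ζ) := by
  set ι₁ := Spec.map (CommRingCat.ofHom (algebraMap S B)) with hι₁
  set ι₂ := Spec.map (CommRingCat.ofHom (algebraMap B Ŝ)) with hι₂
  have hfacι : Spec.map (CommRingCat.ofHom (algebraMap S Ŝ)) = ι₂ ≫ ι₁ := specMap_algebraMap_eq_comp
  -- the two-step base change `X₂ → X₁ → X`
  set π₁ := pullback.snd π ι₁ with hπ₁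
  set σ₁ := pullback.fst π ι₁ with hσ₁
  set σ₂ := pullback.fst π₁ ι₂ with hσ₂
  set π₂ := pullback.snd π₁ ι₂ with hπ₂
  have big : IsPullback (σ₂ ≫ σ₁) π₂ π (ι₂ ≫ ι₁) :=
    IsPullback.paste_horiz (IsPullback.of_hasPullback π₁ ι₂) (IsPullback.of_hasPullback π ι₁)
  rw [← hfacι] at big
  -- `X ×_S Spec Ŝ ≅ X₂` over `X`
  let e := big.isoPullback
  have hfac : (e.inv ≫ σ₂) ≫ σ₁ = pullback.fst π (Spec.map (CommRingCat.ofHom (algebraMap S Ŝ))) := by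
    rw [Category.assoc, big.isoPullback_inv_fst]
  -- the classes of the two steps
  haveI : IsPreimmersion ι₂ := IsPreimmersion.of_isLocalization M
  haveI : Flat ι₂ := by
    rw [hι₂, HasRingHomProperty.Spec_iff (P := @Flat), CommRingCat.hom_ofHom, RingHom.flat_algebraMap_iff]
    exact IsLocalization.flat Ŝ M
  haveI : FormallyUnramified ι₁ := by
    rw [hι₁, HasRingHomProperty.Spec_iff (P := @FormallyUnramified), CommRingCat.hom_ofHom,
      RingHom.formallyUnramified_algebraMap]
    infer_instance
  haveI : LocallyOfFiniteType ι₁ := by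
    rw [hι₁, HasRingHomProperty.Spec_iff (P := @LocallyOfFiniteType), CommRingCat.hom_ofHom,
      RingHom.finiteType_algebraMap]
    infer_instance
  haveI : IsPreimmersion σ₂ := inferInstance
  haveI : Flat σ₂ := inferInstance
  haveI : FormallyUnramified σ₁ := MorphismProperty.pullback_fst π ι₁ (P := @FormallyUnramified) inferInstance
  haveI : LocallyOfFiniteType σ₁ := MorphismProperty.pullback_fst π ι₁ (P := @LocallyOfFiniteType) inferInstance
  haveI : IsPreimmersion (e.inv ≫ σ₂) := inferInstance
  haveI : Flat (e.inv ≫ σ₂) := inferInstance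
  exact map_maximalIdeal_stalkMap_eq_of_fac (e.inv ≫ σ₂) σ₁ hfac ζ

end Summit.ResolutionOfSingularities.ResolutionOfSingularities.Theorems.NoZeno.ExcCount

end
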